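import Mathlib
import Literature.Combinatorics.Enumerative.BregmanMinc

/-!
# `DivisionGap.PerMultiplesHard` (stmt-ValiantsHypothesis-5068), line `uncharged-face-walk`:
stub `stub_bregmanFibre` — Brégman–Minc bounds every block-diagonal fibre of `PM(Y)`

For a bipartite host graph `Y ⊆ [n]²` (cells `(row, column)`), a column set `T` and a row set `U`,
the FIBRE over `(T, U)` is the set `X` of permutations `π` inside `Y` (`(π j, j) ∈ Y` for every
column `j`; `π` maps columns to rows) with `π(T) = U`.  Then

  `#X ≤ ∏_j (d_j !)^(1/d_j)`,

where `d_j = #{i ∈ U : (i, j) ∈ Y}` if `j ∈ T` and `d_j = #{i ∉ U : (i, j) ∈ Y}` if `j ∉ T`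
(`stub_bregmanFibre`).

Proof.  The tree's Brégman–Minc theorem in set form
(`Literature.Combinatorics.Enumerative.card_le_prod_factorial_rpow`, [Bregman1973, Thm 1]) gives
`#X ≤ ∏_j (r_j !)^(1/r_j)` with `r_j = #{π j : π ∈ X}` the row support of `X` at column `j`.
The row support at `j` lies in `{i ∈ U : (i, j) ∈ Y}` if `j ∈ T` (`π j ∈ π(T) = U`) and in
`{i ∉ U : (i, j) ∈ Y}` if `j ∉ T` (`π j ∈ U = π(T)` would give `π j = π j'` with `j' ∈ T`, so
`j = j' ∈ T` by injectivity), hence `r_j ≤ d_j` (`image_apply_subset_degSet`).  Finally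
`r ↦ (r !)^(1/r) = exp (log (r !) / r)` is monotone on `ℕ` (`factorial_rpow_mono`, from
`Literature.Combinatorics.Enumerative.log_factorial_div_mono`; at `r = 0` the value is `1` since
`(1 : ℝ) / 0 = 0`), and `Finset.prod_le_prod` applies (all factors are nonnegative real powers).
-/

noncomputable section

-- `Summit.ValiantsHypothesis.ValiantsHypothesis.…` is the tree's mandated layout (Sub = Summit).
set_option linter.dupNamespace false

namespace Summit.ValiantsHypothesis.ValiantsHypothesis.Theorems.DivisionGap.PerMultiplesHard.BregmanFibre

open Finset Literature.Combinatorics.Enumerative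
open scoped BigOperators

/-- The Brégman factor as an exponential: `(r !)^(1/r) = exp (log (r !) / r)` for every `r : ℕ`
(also at `r = 0`, where both sides are `1`: `(1 : ℝ) / 0 = 0`). [folklore] -/
theorem factorial_rpow_eq_exp (r : ℕ) :
    ((r.factorial : ℕ) : ℝ) ^ ((1 : ℝ) / (r : ℝ)) =
      Real.exp (Real.log ((r.factorial : ℕ) : ℝ) / (r : ℝ)) := by
  rw [Real.rpow_def_of_pos (by exact_mod_cast r.factorial_pos), mul_one_div]

/-- The Brégman factor `r ↦ (r !)^(1/r)` is monotone on `ℕ` (it is `exp (log (r !) / r)` and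
`r ↦ log (r !) / r` is monotone, `log_factorial_div_mono`). [folklore] -/
theorem factorial_rpow_mono :
    Monotone (fun r : ℕ => ((r.factorial : ℕ) : ℝ) ^ ((1 : ℝ) / (r : ℝ))) := by
  intro r d h
  dsimp only
  rw [factorial_rpow_eq_exp, factorial_rpow_eq_exp]
  exact Real.exp_le_exp.mpr (log_factorial_div_mono h)

/-- **Row supports of a fibre.**  For the fibre `X = {π inside Y : π(T) = U}` and a column `j`,
the row support `{π j : π ∈ X}` lies in the degree set `D_j = {i ∈ U : (i, j) ∈ Y}` if `j ∈ T`
and `D_j = {i ∉ U : (i, j) ∈ Y}` if `j ∉ T` (for `j ∉ T`, `π j ∉ U = π(T)` by injectivity of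
`π`). [folklore] -/
theorem image_apply_subset_degSet (n : ℕ) (Y : Finset (Fin n × Fin n)) (T U : Finset (Fin n))
    (j : Fin n) :
    ((Finset.univ : Finset (Equiv.Perm (Fin n))).filter fun π : Equiv.Perm (Fin n) =>
        (∀ j, (π j, j) ∈ Y) ∧ T.image ⇑π = U).image (fun σ => σ j) ⊆
      (if j ∈ T then U.filter fun i => (i, j) ∈ Y else Uᶜ.filter fun i => (i, j) ∈ Y) := by
  intro i hi
  obtain ⟨π, hπ, rfl⟩ := Finset.mem_image.mp hi
  obtain ⟨hY, hTU⟩ := (Finset.mem_filter.mp hπ).2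
  by_cases hj : j ∈ T
  · rw [if_pos hj, Finset.mem_filter]
    refine ⟨?_, hY j⟩
    rw [← hTU]
    exact Finset.mem_image_of_mem _ hj
  · rw [if_neg hj, Finset.mem_filter, Finset.mem_compl]
    refine ⟨fun hU => hj ?_, hY j⟩
    rw [← hTU] at hU
    obtain ⟨j', hj', hjj'⟩ := Finset.mem_image.mp hU
    rw [π.injective hjj'] at hj'
    exact hj'

/-- **stub_bregmanFibre — Brégman–Minc bounds every block-diagonal fibre of `PM(Y)` by the column
degrees of `Y`.**  For a graph `Y ⊆ [n]²` (cells `(row, column)`), a column set `T` and a row set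
`U`, the permutations `π` inside `Y` (`(π j, j) ∈ Y` for all columns `j`) with `π(T) = U` number
at most `∏_j (d_j !)^{1/d_j}`, where `d_j` is the number of `Y`-neighbours of column `j` inside `U`
if `j ∈ T` and inside `Uᶜ` if `j ∉ T`: the fibre is a set `X` of permutations whose row support at
`j` (`{π j : π ∈ X}`) lies in `{i ∈ U : (i, j) ∈ Y}` resp. `{i ∉ U : (i, j) ∈ Y}`
(`image_apply_subset_degSet`), the set form of Brégman–Minc
(`Literature.Combinatorics.Enumerative.card_le_prod_factorial_rpow`) bounds `#X` by
`∏_j (r_j !)^{1/r_j}` with `r_j` the row-support sizes, and `r ↦ (r !)^{1/r}` is monotone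
(`factorial_rpow_mono`; the value at `r = 0` is `1` since `(1 : ℝ) / 0 = 0`).
[cite: Bregman1973, Thm 1] -/
theorem stub_bregmanFibre :
    ∀ (n : ℕ) (Y : Finset (Fin n × Fin n)) (T U : Finset (Fin n)),
      ((((Finset.univ : Finset (Equiv.Perm (Fin n))).filter fun π : Equiv.Perm (Fin n) =>
            (∀ j, (π j, j) ∈ Y) ∧ T.image ⇑π = U).card : ℕ) : ℝ) ≤
        ∏ j : Fin n,
          ((((if j ∈ T then U.filter fun i => (i, j) ∈ Y else Uᶜ.filter fun i => (i, j) ∈ Y).card.factorial : ℕ) : ℝ) ^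
            ((1 : ℝ) / ((if j ∈ T then U.filter fun i => (i, j) ∈ Y else Uᶜ.filter fun i => (i, j) ∈ Y).card : ℝ))) := by
  intro n Y T U
  refine (card_le_prod_factorial_rpow _).trans
    (Finset.prod_le_prod (fun j _ => Real.rpow_nonneg (Nat.cast_nonneg _) _) fun j _ => ?_)
  exact factorial_rpow_mono (Finset.card_le_card (image_apply_subset_degSet n Y T U j))

end Summit.ValiantsHypothesis.ValiantsHypothesis.Theorems.DivisionGap.PerMultiplesHard.BregmanFibre

end
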